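import Summits.Ventures.YMGap.RobustBall.StarChartKernel
import Summits.Ventures.YMGap.RobustBall.StarDoorZdPerturbed
import Summits.Ventures.YMGap.RobustBall.MassGapOnBallZdG
import Summits.Ventures.YMGap.RobustBall.RobustStarDoor
import Summits.Ventures.YMGap.Thresholds.StarChartZd
import HarnessLib

/-!
# Venture YMGap, track ROBUST-BALL (Y2) — crux Y2-X2-Zd, step 5: THE ROBUST VERTEX-STAR DOOR ON `ℤ^d`
# (the mass gap, uniformly on the gauge-invariant tier-1 `ℤ^d` ball, past the single-link threshold)

HONEST FRAMING. WHAT THIS IS: a venture file (cell `pub-ymgap`, track Y2 ROBUST-BALL, seat ds-2). For every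
member `(W, supp)` of the gauge-invariant tier-1 `ℤ^d` ball `MemBallZdG ε₀ ε₁ R` (`MassGapOnBallZdG.lean`) the
star window bound `StarWindowBoundZdR` of the `ℤ^d` star door (`StarDoorZd.lean`) holds for the member's
specification `perturbedYM (fundamentalRep (Fin N)) β W supp`, with locality radius `max R 1 + 2` and the
received sum `ρ = gaugeR d c + (λ + θ^K·4dλ)/(1−θ)` of the TORUS robust star door (`RobustStarDoor.lean`, ds-2 g7)
— `starWindowBoundZdR_of_memBallZdG`. MECHANISM: around each vertex `s` the member is read on the torus of
side `2(R+3)+1` through its CHART MEMBER of the star (`StarChartMember.lean`, `StarChartKernel.lean`), which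
lies in the torus ball of record `ClusterDomainFR ε₀ ε₁ R` (`chartMember_star_mem`); there the robust star
array `Krob` of g7 satisfies (H1)/(H2) (`exists_robustStar_torus_array`, the first half of
`clustersWith_of_robustStar` verbatim); (H1) is pulled back to `ℤ^d` by the window-contraction transfer
(`perturbed_window_contraction_of_torus`) and (H2) by injectivity of the chart on the locality set. With
`ρ < 1` the `ℤ^d` star door gives `MassGapOnBallZdG d N β ε₀ ε₁ R` — `massGapOnBallZdG_of_robustStar`: the unique
DLR state and Shen–Zhu–Zhu clustering for EVERY member, directly in infinite volume. WHAT THIS IS NOT: no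
number (rows are the next file); tier 2 (infinite range) is out of reach of a star door; strong-coupling
LATTICE statement — `ρ < 1` is where the window bound closes, not a transition; no continuum, no Millennium claim.

## References
* R. L. Dobrushin, S. B. Shlosman (1985), Thm. 1; H. Föllmer, LNM 1362 (1988) Ch. I; H.-O. Georgii (2011) §8.2.
* The tree: `RobustBall/RobustStarDoor.lean` (g7, torus door), `RobustBall/StarDoorZd(Perturbed).lean`,
  `RobustBall/StarChartMember.lean`, `RobustBall/StarChartKernel.lean`, `Thresholds/StarChartZd.lean` (ds-1).
-/

noncomputable section

open MeasureTheory ProbabilityTheory Function Finset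
open Literature.Probability.LatticeModels
open Literature.Probability.LatticeModels.DobrushinMetric
open Literature.MathematicalPhysics.QuantumLattice hiding torusNorm
open Literature.MathematicalPhysics.QuantumFieldTheory hiding ZdEdge
open Literature.MathematicalPhysics.QuantumFieldTheory.Balaban1983to89.StrongCouplingTorusWindow
open Literature.MathematicalPhysics.QuantumFieldTheory.Balaban1983to89.StrongCouplingDobrushinWindow
  (OneLinkKRModulus)
open Summit.Ventures.YMGap.DSWindow
open Summit.Ventures.YMGap.DSWindowZd
open Summit.Ventures.YMGap.StarKernel
open Summit.Ventures.YMGap.StarResolventDim (Delta gaugeR doorPoly Delta_pos_of_door gaugeR_lt_one_of_door)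
open Summit.Ventures.YMGap.StarLemmaGDim
open Summit.Ventures.YMGap.RobustStar

namespace Summit.Ventures.YMGap.RobustBall

variable {d L N : ℕ}

/-! ### The torus data of the robust star door for one member (first half of `clustersWith_of_robustStar`) -/

/-- **The robust star array of a member of the torus ball of record**: (H1) for the perturbed star kernels,
(H2) received sum `≤ ρ`, support on links whose endpoints are within `max r 1 + 2` of the vertex — the data
`clustersWith_of_robustStar` feeds to the torus certificate, exported. [folklore] -/
theorem exists_robustStar_torus_array [NeZero L] (hd : 2 ≤ d) (hN : 1 ≤ N) (hL : 3 ≤ L)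
    {β ε₀ ε₁ R K c lam θ ρ : ℝ} {r Kn : ℕ}
    (hK : 0 ≤ K) (hR : |β| / N * (2 * ((d : ℝ) - 1)) ≤ R) (hmod : OneLinkKRModulus N R K) (hε₁ : 0 ≤ ε₁)
    (hc : K * Real.exp ε₀ * (1 + 2 * Real.sqrt N * ε₁) * (|β| / N) ≤ c) (hlam : Real.sqrt N * ε₁ ≤ lam)
    (hθ : θ = (2 * (d : ℝ) - 2) * c + lam) (hθ1 : θ < 1) (hcd : doorPoly d c < 1)
    (hρ : ρ = gaugeR d c + (lam + θ ^ Kn * (4 * d * lam)) / (1 - θ))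
    {W : Perturbation d L N} (hW : W ∈ ClusterDomainFR ε₀ ε₁ r) :
    ∃ Kt : Site d L → Edge d L → Edge d L → ℝ,
      (∀ s y x, 0 ≤ Kt s y x) ∧
      IsWindowKRContraction (perturbedTorusSpec W β) (id : Edge d L → Edge d L) (linkWeight suFrobDist)
        starWin starWin (fun e => Kt e.1) ∧
      (∀ (s : Site d L) (x : Edge d L), x ∈ vertexStar s → ∑ y, Kt s y x ≤ ρ) ∧
      (∀ (s : Site d L) (y x : Edge d L), Kt s y x ≠ 0 → ∀ w' ∈ linkEnds y, torusNorm (s - w') ≤ max r 1 + 2) := by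
  classical
  obtain ⟨hr, w, hwa, hwℓ⟩ := exists_witness_of_mem_clusterDomainFR hW
  have hL1 : 1 < L := by omega
  have hd1 : 1 ≤ d := by omega
  have hc0 : 0 ≤ c := le_trans (by positivity) hc
  have hlam0 : 0 ≤ lam := le_trans (by positivity) hlam
  have hΔ : 0 < Delta d c := Delta_pos_of_door hd hc0 hcd
  have hgR : 0 ≤ gaugeR d c ∧ gaugeR d c < 1 := gaugeR_lt_one_of_door hd hc0 hcd
  have hd2 : (2 : ℝ) ≤ d := by exact_mod_cast hd
  have hθ0 : 0 ≤ θ := by rw [hθ]; nlinarith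
  -- the robust single-link matrix, extended to all links with the off-column array `E`
  set nbr : Edge d L → Finset (Edge d L) := fun e => (univ.erase e).filter fun y => torusNorm (e.1 - y.1) ≤ max r 1
    with hnbr
  set E : Edge d L → Edge d L → ℝ := fun x z => if z ∈ nbr x then Real.sqrt N * w.crossLip 0 x z else 0 with hEdef
  have hE0 : ∀ x z, 0 ≤ E x z := fun x z => by
    simp only [hEdef]; split_ifs
    · exact mul_nonneg (Real.sqrt_nonneg _) (crossLip_nonneg w 0 x z)
    · exact le_rfl
  have hKR := isKRContraction_perturbedTorusSpec_of_hasRange hd1 hN hL1 hK hR hmod w hr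
  have hcoef : ∀ x : Edge d L,
      K * Real.exp (w.oscLoad 0 x) * (1 + 2 * Real.sqrt N * w.selfLipLoad 0 x) * (|β| / N) ≤ c := by
    intro x
    refine le_trans ?_ hc
    have h1 : Real.exp (w.oscLoad 0 x) ≤ Real.exp ε₀ := Real.exp_le_exp.2 (hwa x)
    have h2 : w.selfLipLoad 0 x ≤ ε₁ := by linarith [hwℓ x, crossLipLoad_nonneg w 0 x]
    have h3 : 0 ≤ w.selfLipLoad 0 x := selfLipLoad_nonneg w 0 x
    gcongr
  have hKR' : IsKRContraction (perturbedTorusSpec W β) suFrobDist (fun e => univ.erase e) (Cst c E) := by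
    refine isKRContraction_univ_of_le hKR (fun a b => suFrobDist_nonneg a b) (Cst_nonneg hc0 hE0) fun x y hy => ?_
    have hEy : E x y = Real.sqrt N * w.crossLip 0 x y := by simp only [hEdef]; exact if_pos hy
    have ht : (0 : ℝ) ≤ tInfluence x y := Nat.cast_nonneg _
    simp only [Cst]
    rw [hEy]
    nlinarith [mul_nonneg (sub_nonneg.2 (hcoef x)) ht]
  have hlamrow : ∀ x, ∑ z ∈ univ.erase x, E x z ≤ lam := by
    intro x
    calc ∑ z ∈ univ.erase x, E x z ≤ ∑ z ∈ univ.erase x, Real.sqrt N * w.crossLip 0 x z :=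
          sum_le_sum fun z _ => by
            simp only [hEdef]; split_ifs
            · exact le_rfl
            · exact mul_nonneg (Real.sqrt_nonneg _) (crossLip_nonneg w 0 x z)
      _ = Real.sqrt N * w.crossLipLoad 0 x := by rw [← mul_sum]; rfl
      _ ≤ Real.sqrt N * ε₁ := by
          refine mul_le_mul_of_nonneg_left ?_ (Real.sqrt_nonneg _)
          linarith [hwℓ x, selfLipLoad_nonneg w 0 x]
      _ ≤ lam := hlam
  have hrow : ∀ (s : Site d L), ∀ x ∈ vertexStar s, ∑ z ∈ (vertexStar s).erase x, Cst c E x z ≤ θ := by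
    intro s x hx; rw [hθ]; exact sum_star_erase_Cst_le hL hc0 hE0 hlamrow hx
  refine ⟨Krob c E θ Kn, fun s y x => Krob_nonneg hd hc0 hΔ hE0 hθ0 hθ1 Kn s y x,
    robust_star_window (W := W) (β := β) hd hL hc0 hΔ hE0 hθ0 hθ1 hrow hKR' Kn, fun s x hx => ?_, fun s y x hk w' hw' => ?_⟩
  · rw [hρ]; exact sum_Krob_le hd hL hc0 hΔ hgR.2.le hE0 hlamrow hθ0 hθ1 (hrow s) hx
  · have hyw : torusNorm (y.1 - w') ≤ 1 := torusNorm_fst_sub_linkEnds_le_one hw'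
    rcases mem_starBoundary_or_of_Krob_ne_zero hk with hyb | ⟨x', hx', hE'⟩
    · have := torusNorm_le_one_of_mem_starBoundary hyb hw'
      omega
    · have hyn : y ∈ nbr x' := by
        by_contra h
        exact hE' (by simp only [hEdef, if_neg h])
      have hxy : torusNorm (x'.1 - y.1) ≤ max r 1 := (mem_filter.1 hyn).2
      have hsx : torusNorm (s - x'.1) ≤ 1 := torusNorm_sub_fst_le_one_of_mem_vertexStar hx'
      have t1 := torusNorm_sub_le s x'.1 y.1
      have t2 := torusNorm_sub_le s y.1 w'
      omega

/-! ### The chart member of a star lies in the torus ball of record -/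

/-- Locality sets of a vertex are monotone in the radius. [folklore] -/
theorem starNbhdZdR_mono {D D' : ℕ} (h : D ≤ D') (s : Literature.Probability.LatticeModels.Site d) :
    starNbhdZdR D s ⊆ starNbhdZdR D' s :=
  fun _ hy => mem_starNbhdZdR.2 fun i => ((mem_starNbhdZdR.1 hy) i).trans h

/-- Injectivity of reduction mod `L` on the base sites of a locality set of radius `D` with `2D < L`. [folklore] -/
theorem injOn_torusProj_starNbhdZdR {D : ℕ} (hL : 2 * D < L) (s : Literature.Probability.LatticeModels.Site d) :
    Set.InjOn (Torus.proj L) ((starNbhdZdR D s).image Prod.fst : Set (Literature.Probability.LatticeModels.Site d)) := by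
  refine KernelTransfer.injOn_torusProj_of_near hL s fun x hx i => ?_
  obtain ⟨y, hy, rfl⟩ := Finset.mem_image.1 (Finset.mem_coe.1 hx)
  have h := (mem_starNbhdZdR.1 hy) i
  rw [Int.abs_eq_natAbs]
  exact_mod_cast h

/-- Injectivity of `torusEdge L` on a locality set of radius `D` with `2D < L`. [folklore] -/
theorem injOn_torusEdge_starNbhdZdR {D : ℕ} (hL : 2 * D < L) (s : Literature.Probability.LatticeModels.Site d) :
    Set.InjOn (torusEdge L) (starNbhdZdR D s : Set (ZdEdge d)) :=
  injOn_torusEdge (injOn_torusProj_starNbhdZdR hL s)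

/-- An ACTIVE set of the star of `s` (meeting the star, nonzero term) has all its links within `R + 1` of `s`
(`R` the range). [folklore] -/
theorem active_star_subset {ε₀ ε₁ : ℝ} {R : ℕ} {W : Potential (ZdEdge d) (SUN N)}
    {supp : Finset (ZdEdge d) → Finset (Finset (ZdEdge d))} (hW : MemBallZdG ε₀ ε₁ R W supp)
    (s : Literature.Probability.LatticeModels.Site d)
    {X : Finset (ZdEdge d)} (hne : (X ∩ vertexStarZd s).Nonempty) (hX0 : W X ≠ 0) {e : ZdEdge d} (he : e ∈ X) :
    e ∈ starNbhdZdR (R + 1) s := by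
  classical
  obtain ⟨e₀, he₀⟩ := hne
  obtain ⟨he₀X, he₀s⟩ := Finset.mem_inter.1 he₀
  have hsupp : X ∈ supp {e₀} :=
    hW.supportedBy {e₀} X ⟨e₀, Finset.mem_inter.2 ⟨he₀X, Finset.mem_singleton_self e₀⟩⟩ hX0
  have h1 : ‖e.1 - e₀.1‖ ≤ (R : ℝ) := by rw [norm_sub_rev]; exact hW.range e₀ X hsupp he₀X e he
  refine mem_starNbhdZdR.2 fun i => ?_
  have h2 := natAbs_le_of_norm_le h1 i
  have h3 := natAbs_sub_le_one_of_mem_vertexStarZd he₀s i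
  simp only [Pi.sub_apply] at h2
  have : e.1 i - s i = (e.1 i - e₀.1 i) + (e₀.1 i - s i) := by ring
  rw [this]
  exact (Int.natAbs_add_le _ _).trans (by omega)

/-- **The chart member of an active family of the star of `s` lies in the torus ball of record
`ClusterDomainFR ε₀ ε₁ R`** on every torus of side `L > 2(R+1)`, for every member of the gauge-invariant `ℤ^d`
ball. [folklore] -/
theorem chartMember_star_mem [NeZero L] (hd : 1 ≤ d) {ε₀ ε₁ : ℝ} {R : ℕ} {W : Potential (ZdEdge d) (SUN N)}
    {supp : Finset (ZdEdge d) → Finset (Finset (ZdEdge d))} (hW : MemBallZdG ε₀ ε₁ R W supp)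
    (hm : ∀ X, Measurable (W X)) (hb : ∀ X, ∃ C, ∀ U, |W X U| ≤ C) (hL : 2 * (R + 1) < L)
    (s : Literature.Probability.LatticeModels.Site d)
    {S : Finset (Finset (ZdEdge d))}
    (hS : ∀ X, X ∈ S ↔ X ∈ supp (vertexStarZd s) ∧ (X ∩ vertexStarZd s).Nonempty ∧ W X ≠ 0) :
    chartMember L S W hW.dependsOn hW.gaugeInvariant hm hb ∈ ClusterDomainFR ε₀ ε₁ R := by
  classical
  obtain ⟨osc, lip, hosc, hlip, h₀, h₁⟩ := hW.loads
  have hd0 : 0 < d := hd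
  have hε₀ : 0 ≤ ε₀ :=
    le_trans (Finset.sum_nonneg fun X _ => (hosc X).nonneg _)
      (h₀ ((0 : Literature.Probability.LatticeModels.Site d), ⟨0, hd0⟩))
  have hε₁ : 0 ≤ ε₁ :=
    le_trans (Finset.sum_nonneg fun X _ => Finset.sum_nonneg fun y _ => (hlip X).nonneg y)
      (h₁ (0 : Literature.Probability.LatticeModels.Site d))
  refine chartMember_mem_clusterDomainFR (B := (starNbhdZdR (R + 1) s).image Prod.fst)
    (injOn_torusProj_starNbhdZdR hL s)
    (fun X hX e he => Finset.mem_image_of_mem _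
      (active_star_subset hW s ((hS X).1 hX).2.1 ((hS X).1 hX).2.2 he)) hosc hlip
    (fun X hX a ha b hb => ?_) hε₀ hε₁ (fun e => ?_) (fun v => ?_)
  · obtain ⟨-, -, hX0⟩ := (hS X).1 hX
    exact hW.range a X (hW.supportedBy {a} X ⟨a, Finset.mem_inter.2 ⟨ha, Finset.mem_singleton_self a⟩⟩ hX0)
      ha b hb
  · refine le_trans (Finset.sum_le_sum_of_subset_of_nonneg (fun X hX => ?_) fun X _ _ => (hosc X).nonneg e)
      (h₀ e)
    obtain ⟨hXS, heX⟩ := Finset.mem_filter.1 hX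
    obtain ⟨-, -, hX0⟩ := (hS X).1 hXS
    exact Finset.mem_filter.2
      ⟨hW.supportedBy {e} X ⟨e, Finset.mem_inter.2 ⟨heX, Finset.mem_singleton_self e⟩⟩ hX0, heX⟩
  · refine le_trans (Finset.sum_le_sum_of_subset_of_nonneg (fun X hX => ?_)
      fun X _ _ => Finset.sum_nonneg fun y _ => (hlip X).nonneg y) (h₁ v)
    obtain ⟨hXS, hvX⟩ := Finset.mem_filter.1 hX
    obtain ⟨-, -, hX0⟩ := (hS X).1 hXS
    obtain ⟨e, he, rfl⟩ := Finset.mem_image.1 hvX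
    exact mem_listedAt_of_ne_zero hW.supportedBy hX0 he

/-! ### The star window bound on `ℤ^d` for every member of the gauge-invariant ball -/

/-- **THE ROBUST VERTEX-STAR DOOR ON `ℤ^d`: the star window bound for every member of `MemBallZdG ε₀ ε₁ R`.**
Hypotheses = those of the torus robust star door (`torusClusteringOnBall_of_robustStar`: dimension `d ≥ 2`, a
one-link modulus `OneLinkKRModulus N Rm K` on the radius `Rm ≥ 2(d−1)|β|/N`, the robust coefficient
`K e^{ε₀}(1 + 2√N ε₁)|β|/N ≤ c` below the door `doorPoly d c < 1`, `λ ≥ √N ε₁`, `θ = (2d−2)c + λ < 1`,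
`ρ = gaugeR d c + (λ + θ^Kn·4dλ)/(1−θ)`), tree coupling `β`. Conclusion: `StarWindowBoundZdR` for
`perturbedYM (fundamentalRep (Fin N)) β W supp` with locality radius `max R 1 + 2` and received sum `ρ`.
[folklore] -/
theorem starWindowBoundZdR_of_memBallZdG (hd : 2 ≤ d) (hN : 1 ≤ N) {β ε₀ ε₁ Rm K c lam θ ρ : ℝ} {R Kn : ℕ}
    (hK : 0 ≤ K) (hRm : |β| / N * (2 * ((d : ℝ) - 1)) ≤ Rm) (hmod : OneLinkKRModulus N Rm K) (hε₁ : 0 ≤ ε₁)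
    (hc : K * Real.exp ε₀ * (1 + 2 * Real.sqrt N * ε₁) * (|β| / N) ≤ c) (hlam : Real.sqrt N * ε₁ ≤ lam)
    (hθ : θ = (2 * (d : ℝ) - 2) * c + lam) (hθ1 : θ < 1) (hcd : doorPoly d c < 1)
    (hρ : ρ = gaugeR d c + (lam + θ ^ Kn * (4 * d * lam)) / (1 - θ))
    {W : Potential (ZdEdge d) (SUN N)} {supp : Finset (ZdEdge d) → Finset (Finset (ZdEdge d))}
    (hW : MemBallZdG ε₀ ε₁ R W supp) :
    StarWindowBoundZdR d N (perturbedYM (d := d) (fundamentalRep (Fin N)) β W supp) (max R 1 + 2) ρ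
      suFrobDist := by
  classical
  haveI : SecondCountableTopology (Matrix (Fin N) (Fin N) ℂ) :=
    inferInstanceAs (SecondCountableTopology (Fin N → Fin N → ℂ))
  haveI : SecondCountableTopology (SUN N) := Topology.IsEmbedding.subtypeVal.secondCountableTopology
  have hd1 : 1 ≤ d := by omega
  -- the torus of side `2(R+3)+1` around each vertex
  set L : ℕ := 2 * (R + 3) + 1 with hLdef
  haveI : NeZero L := ⟨by omega⟩
  have hL3 : 3 ≤ L := by omega
  have hLR3 : 2 * (R + 3) < L := by omega
  have hLR1 : 2 * (R + 1) < L := by omega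
  have hDR : max R 1 + 2 ≤ R + 3 := by omega
  -- the active family and the chart member of each star, and its torus array
  set Sact : (Literature.Probability.LatticeModels.Site d) → Finset (Finset (ZdEdge d)) := fun s =>
    (supp (vertexStarZd s)).filter fun X => (X ∩ vertexStarZd s).Nonempty ∧ W X ≠ 0 with hSact_def
  have hSact : ∀ (s : Literature.Probability.LatticeModels.Site d) X,
      X ∈ Sact s ↔ X ∈ supp (vertexStarZd s) ∧ (X ∩ vertexStarZd s).Nonempty ∧ W X ≠ 0 :=
    fun s X => Finset.mem_filter
  have hmW : ∀ X, Measurable (W X) := fun X => (hW.continuous X).measurable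
  have hbW : ∀ X, ∃ C, ∀ U, |W X U| ≤ C := fun X => exists_bound_of_continuous (hW.continuous X)
  set Wc : (Literature.Probability.LatticeModels.Site d) → Perturbation d L N := fun s =>
    chartMember L (Sact s) W hW.dependsOn hW.gaugeInvariant hmW hbW with hWc
  have hmem : ∀ s, Wc s ∈ ClusterDomainFR ε₀ ε₁ R := fun s => chartMember_star_mem hd1 hW hmW hbW hLR1 s (hSact s)
  choose Kt hKt0 hcontr hsumt hloct using fun s =>
    exists_robustStar_torus_array hd hN hL3 hK hRm hmod hε₁ hc hlam hθ hθ1 hcd hρ (hmem s)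
  -- injectivity of the chart on the big locality set of radius `R + 3`
  have hinj3 : ∀ s : Literature.Probability.LatticeModels.Site d,
      Set.InjOn (torusEdge L) (starNbhdZdR (R + 3) s : Set (ZdEdge d)) :=
    fun s => injOn_torusEdge_starNbhdZdR hLR3 s
  have hstar3 : ∀ s : Literature.Probability.LatticeModels.Site d, vertexStarZd s ⊆ starNbhdZdR (R + 3) s :=
    fun s => vertexStarZd_subset_starNbhdZdR (by omega) s
  have hD3 : ∀ s : Literature.Probability.LatticeModels.Site d, starNbhdZdR (max R 1 + 2) s ⊆ starNbhdZdR (R + 3) s :=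
    fun s => starNbhdZdR_mono hDR s
  refine ⟨fun s y x => if y ∈ starNbhdZdR (max R 1 + 2) s then
      Kt s (Torus.proj L s) (torusEdge L y) (torusEdge L x) else 0, ?_, ?_, ?_, ?_⟩
  · -- nonnegativity
    intro s y x
    dsimp only
    split_ifs
    · exact hKt0 _ _ _ _
    · exact le_rfl
  · -- support in the locality set
    intro s y x h
    by_contra hy
    exact h (if_neg hy)
  · -- (H1)
    intro c y hyc ω η hωη f δ hfm hfb hfdep hδ0 hδ
    set s : Literature.Probability.LatticeModels.Site d := c.1 with hs
    by_cases hyN : y ∈ starNbhdZdR (max R 1 + 2) s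
    swap
    · -- off the locality set: the kernel does not see `y`, the array vanishes
      have heq := perturbed_star_hloc (fundamentalRep (Fin N)) (continuous_fundamentalRep (Fin N)) β
        (fun X => (hW.continuous X).measurable) hW.dependsOn hW.supportedBy hW.range (le_refl (R + 2)) c ω η
        (fun v hv => hωη v (by rintro rfl; exact hyN (starNbhdZdR_mono (by omega) s hv))) f hfm hfdep
      rw [heq, sub_self, abs_zero]
      refine mul_nonneg (Finset.sum_nonneg fun x _ => mul_nonneg ?_ (hδ0 x)) (suFrobDist_nonneg _ _)
      simp only [if_neg hyN, le_refl]
    -- on the locality set: the window-contraction transfer through the chart member of the star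
    have hK : ∀ x, (if y ∈ starNbhdZdR (max R 1 + 2) s then
        Kt s (Torus.proj L s) (torusEdge L y) (torusEdge L x) else 0) =
        (fun x' => Kt s (Torus.proj L s) (torusEdge L y) x') (torusEdge L x) := fun x => if_pos hyN
    simp_rw [hK]
    have hy3 : y ∈ starNbhdZdR (R + 3) s := hD3 s hyN
    -- injectivity on the transfer set
    have hsub : insert y ((starWinZd c ∪ (starWinZd c).biUnion (perturbedNbr supp)) ∪
        (plaquettesTouching (starWinZd c)).biUnion plaquetteEdges) ⊆ starNbhdZdR (R + 3) s := by
      intro e he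
      rcases Finset.mem_insert.1 he with rfl | he
      · exact hy3
      rcases Finset.mem_union.1 he with he | he
      · exact starNbhdZdR_mono (by omega) s (star_collar_subset_starNbhdZdR hW.range (le_refl (R + 2)) s he)
      · exact starNbhdZdR_mono (by omega) s
          (starNbhdZd_subset_starNbhdZdR (le_refl 2) s (Finset.mem_union_right _ he))
    have hLinj : Set.InjOn (Torus.proj L)
        ((insert y ((starWinZd c ∪ (starWinZd c).biUnion (perturbedNbr supp)) ∪
          (plaquettesTouching (starWinZd c)).biUnion plaquetteEdges)).image Prod.fst :
          Set (Literature.Probability.LatticeModels.Site d)) :=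
      (injOn_torusProj_starNbhdZdR hLR3 s).mono (Finset.coe_subset.2 (Finset.image_subset_image hsub))
    -- the projected boundary link is off the torus star
    have hwin : (starWinZd c).image (torusEdge L) = starWin (torusEdge L c) := image_torusEdge_vertexStarZd s
    have hy' : torusEdge L y ∉ starWin (torusEdge L c) := by
      rw [← hwin]
      intro hmem
      obtain ⟨x, hx, hxy⟩ := Finset.mem_image.1 hmem
      exact hyc ((hinj3 s) (hstar3 s hx) hy3 hxy ▸ hx)
    -- the torus (H1) of the chart member, in the shape of the transfer lemma
    refine perturbed_window_contraction_of_torus (β := β) hW.dependsOn hW.gaugeInvariant hmW hbW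
      hW.supportedBy (starWinZd c) (hSact s) hLinj (k' := fun x' => Kt s (Torus.proj L s) (torusEdge L y) x') ?_ hωη
      hfm hfb hfdep hδ0 hδ
    intro V V' hVV' f' δ' hf'm hf'b hf'dep hδ'0 hlip'
    rw [hwin] at hf'dep ⊢
    exact hcontr s (torusEdge L c) (torusEdge L y) hy' V V' (fun v hv => hVV' v hv) f' δ' hf'm hf'b hf'dep hδ'0
      fun x U U' hUU' => hlip' x U U' fun e' he' => hUU' e' he'
  · -- (H2)
    intro s x hx
    have hx' : torusEdge L x ∈ vertexStar (Torus.proj L s) := torusEdge_mem_vertexStar_proj hx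
    have hinjD : Set.InjOn (torusEdge L) (starNbhdZdR (max R 1 + 2) s : Set (ZdEdge d)) :=
      (hinj3 s).mono (Finset.coe_subset.2 (hD3 s))
    have h1 : ∑ y ∈ starNbhdZdR (max R 1 + 2) s, (if y ∈ starNbhdZdR (max R 1 + 2) s then
          Kt s (Torus.proj L s) (torusEdge L y) (torusEdge L x) else 0) =
        ∑ y ∈ starNbhdZdR (max R 1 + 2) s, Kt s (Torus.proj L s) (torusEdge L y) (torusEdge L x) :=
      Finset.sum_congr rfl fun y hy => if_pos hy
    have h2 : ∑ y ∈ (starNbhdZdR (max R 1 + 2) s).image (torusEdge L), Kt s (Torus.proj L s) y (torusEdge L x) =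
        ∑ y ∈ starNbhdZdR (max R 1 + 2) s, Kt s (Torus.proj L s) (torusEdge L y) (torusEdge L x) :=
      Finset.sum_image fun a ha b hb h => hinjD ha hb h
    have h3 : ∑ y ∈ (starNbhdZdR (max R 1 + 2) s).image (torusEdge L), Kt s (Torus.proj L s) y (torusEdge L x) ≤
        ∑ y, Kt s (Torus.proj L s) y (torusEdge L x) :=
      Finset.sum_le_sum_of_subset_of_nonneg (Finset.subset_univ _) fun y _ _ => hKt0 _ _ _ _
    rw [h1, ← h2]
    exact h3.trans (hsumt s _ _ hx')

/-! ### The mass gap on the gauge-invariant `ℤ^d` ball -/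

/-- **THE MASS GAP, UNIFORMLY ON THE GAUGE-INVARIANT TIER-1 `ℤ^d` BALL, THROUGH THE ROBUST STAR DOOR.** Under
the hypotheses of `starWindowBoundZdR_of_memBallZdG` at tree coupling `N β` ('t Hooft `β`) and `ρ < 1`:
`MassGapOnBallZdG d N β ε₀ ε₁ R` — every member has exactly one DLR state and Shen–Zhu–Zhu exponential
clustering of Lipschitz cylinder observables (`perturbedMassGapAt_of_starWindowBoundZdR`, infinite volume
throughout). [folklore] -/
theorem massGapOnBallZdG_of_robustStar (hd : 2 ≤ d) (hN : 1 ≤ N) {β ε₀ ε₁ Rm K c lam θ ρ : ℝ} {R Kn : ℕ}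
    (hK : 0 ≤ K) (hRm : |(N : ℝ) * β| / N * (2 * ((d : ℝ) - 1)) ≤ Rm) (hmod : OneLinkKRModulus N Rm K)
    (hε₁ : 0 ≤ ε₁) (hc : K * Real.exp ε₀ * (1 + 2 * Real.sqrt N * ε₁) * (|(N : ℝ) * β| / N) ≤ c)
    (hlam : Real.sqrt N * ε₁ ≤ lam) (hθ : θ = (2 * (d : ℝ) - 2) * c + lam) (hθ1 : θ < 1)
    (hcd : doorPoly d c < 1) (hρ : ρ = gaugeR d c + (lam + θ ^ Kn * (4 * d * lam)) / (1 - θ)) (hρ1 : ρ < 1) :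
    MassGapOnBallZdG d N β ε₀ ε₁ R := by
  intro W supp hW
  have hc0 : 0 ≤ c := le_trans (by positivity) hc
  have hlam0 : 0 ≤ lam := le_trans (by positivity) hlam
  have hgR : 0 ≤ gaugeR d c ∧ gaugeR d c < 1 := gaugeR_lt_one_of_door hd hc0 hcd
  have hd2 : (2 : ℝ) ≤ d := by exact_mod_cast hd
  have hθ0 : 0 ≤ θ := by rw [hθ]; nlinarith
  have h1θ : 0 < 1 - θ := by linarith
  have hρ0 : 0 ≤ ρ := by
    rw [hρ]
    refine add_nonneg hgR.1 (div_nonneg (add_nonneg hlam0 ?_) h1θ.le)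
    have : 0 ≤ θ ^ Kn := pow_nonneg hθ0 Kn
    positivity
  exact perturbedMassGapAt_of_starWindowBoundZdR hW.continuous hW.dependsOn hW.supportedBy hW.range
    (by omega) hρ0 hρ1 (starWindowBoundZdR_of_memBallZdG hd hN hK hRm hmod hε₁ hc hlam hθ hθ1 hcd hρ hW)

end Summit.Ventures.YMGap.RobustBall

end
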